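import Summits.CriticalPhenomena.PercolationContinuityZ3.Theorems.PercNearOneGluingNoHeavyQuantDIBStar
import Summits.CriticalPhenomena.PercolationContinuityZ3.Theorems.PercNearOneGluingNoHeavyQuantIndepBlobGapCompanion
import HarnessLib

/-!
# QUANT lane R8, FAR on general trees — the COMPANION certificates of the gap calculus as TERM rules for the root row
# (`Quant.RootDec.rtail_ge_of_terms` / `rtail_ge_of_gapCerts`): companion cloud, one light + companion

builds on p205010 (kernel theorem, internal audit signed; external expert review pending)

Support file (`--supports stmt-CriticalPhenomena-4575`), QUANT lane lead (gen 16), rung R8 of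
`run/shared/lean/prim/quant/LADDER.md`; memo `run/shared/lean/prim/quant/prim-quant-lead-g16/LEAD-NOTES-G16.md` N30–N31.
Theorems only, no definitions, no sorries, standard axioms.

A TERM of the root decomposition is `TERM[s, a, g, j] = P(s + Σ_{k open} a k ≥ j+1)` — a sure mass `s` plus independent blobs
(`…QuantRootReduction`; by `RootDec.term_shift` it is the standard tail at layer `j − s`).  The certificate menu of R3 so far: β (sure),
α (giant), α′ (heavy total `≥ 2(j−s)+1` plus extra blobs), α″/γ (discounted credit at floors `≤ 1/2`), ε (Cantelli), δ (light giant
split), and γ‴ (`RootDec.term_ge_of_gapCert`, typer g18 `…QuantRootReductionGapCert`: the lead's splitting certificate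
`IndepBlob.tail_ge_of_gapCert` as a finite gap check on the term's non-heavy part).  This file adds the two CLOSED-FORM companion
rules of part (II) of the gap calculus (`…QuantIndepBlobGapCompanion`), each a one-line transport through `term_shift` — instances
of γ‴ in which the gap check has been done once and for all:
* `Quant.RootDec.term_ge_of_companion_cloud` — one heavy companion `k₀` of size `≥` the shortfall plus a cloud `L` (any gates) with
  `x(1 − g k₀)·P(N_L ≤ u) ≤ (1 − x)·g k₀·P(N_L ≥ e₀ − u)`, `u < e₀` ⟹ `x ≤ TERM`.
* `Quant.RootDec.term_ge_of_companion_oneLight` — one blob `ℓ` of any gate plus a companion `k₀` with `odds(g k₀)·odds(g ℓ) ≥ odds(x)`,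
  both of size `≥` the shortfall ⟹ `x ≤ TERM`.
(The matching row of part III, `IndepBlob.tail_ge_of_matched_companions`, is transported the same way in `…QuantRootDecGapMatching`.)

[this work]; the gluing rows served: [cite: KozmaNitzan2024, Conjecture 3 (p. 15)].
-/

namespace Summit.CriticalPhenomena.PercolationContinuityZ3.Theorems

namespace Quant

namespace RootDec

open Finset

variable {κ : Type} [Fintype κ] [DecidableEq κ]

/-- product-Bernoulli weight of the set `W` of open blobs (as in `…QuantRootReduction`) -/
local notation3 "wt[" g ", " W "]" => ∏ k, (if k ∈ (W : Finset κ) then (g : κ → ℝ) k else 1 - (g : κ → ℝ) k)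

/-- the TERM tail `P(s + Σ_{k open} a k ≥ j+1)` (as in `…QuantRootReduction`) -/
local notation3 "TERM[" s ", " a ", " g ", " j "]" =>
  ∑ W : Finset κ, wt[g, W] * (if (j : ℕ) + 1 ≤ (s : ℕ) + ∑ k ∈ W, (a : κ → ℕ) k then (1 : ℝ) else 0)

/-- **The companion-cloud certificate as a TERM rule.**  Gates in `[0,1]`, floor `1/2 ≤ x ≤ 1`; a cloud `L`, a companion `k₀ ∉ L` with
`x ≤ g k₀`, every other blob heavy; with `A''` the total size of the other blobs and `e₀ = 2(j − s) + 1 − A'' − a k₀`: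
`a k₀ ≥ e₀` (as `2(j − s) + 1 ≤ A'' + 2·a k₀`) and, for all `y, w ≥ 1` with `y + w = e₀ + 1`,
`x(1 − g k₀)(1 − TL_L(y)) ≤ (1 − x)·g k₀·TL_L(w)` ⟹ `x ≤ TERM[s, a, g, j]`.  (`IndepBlob.tail_ge_of_companion_cloud`.) [this work] -/
theorem term_ge_of_companion_cloud (s : ℕ) (a : κ → ℕ) (g : κ → ℝ) (j : ℕ) (x : ℝ) (hx : 1 / 2 ≤ x) (hx1 : x ≤ 1)
    (hg : ∀ k, 0 ≤ g k ∧ g k ≤ 1) (L : Finset κ) (k₀ : κ) (hk₀ : k₀ ∉ L) (hk₀x : x ≤ g k₀)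
    (hheavy : ∀ k, k ∉ insert k₀ L → x ≤ g k)
    (hbig : 2 * (j - s) + 1 ≤ (∑ k ∈ (insert k₀ L)ᶜ, a k) + 2 * a k₀)
    (hcloud : ∀ y w : ℕ, 1 ≤ y → 1 ≤ w → y + w + (∑ k ∈ (insert k₀ L)ᶜ, a k) + a k₀ = 2 * (j - s) + 2 →
      x * (1 - g k₀) * (1 - ∑ W ∈ L.powerset, (∏ i ∈ L, (if i ∈ W then g i else 1 - g i)) *
              (if y ≤ ∑ i ∈ W, a i then (1 : ℝ) else 0)) ≤
        (1 - x) * g k₀ * ∑ W ∈ L.powerset, (∏ i ∈ L, (if i ∈ W then g i else 1 - g i)) *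
              (if w ≤ ∑ i ∈ W, a i then (1 : ℝ) else 0)) :
    x ≤ TERM[s, a, g, j] := by
  by_cases hs : j + 1 ≤ s
  · rw [term_eq_one_of_sure s a g j hs]; exact hx1
  rw [term_shift s a g j (by omega)]
  exact IndepBlob.tail_ge_of_companion_cloud g a x hx hx1 (fun k => (hg k).1) (fun k => (hg k).2) L k₀ hk₀ hk₀x hheavy
    (j - s) hbig hcloud

/-- **One light blob and one companion as a TERM rule.**  Gates in `[0,1]`, floor `1/2 ≤ x ≤ 1`; a blob `ℓ` of any gate, a companion
`k₀ ≠ ℓ` with `x ≤ g k₀`, all other blobs heavy with total size `A''`; `2(j − s) + 1 ≤ A'' + 2·a k₀`, `2(j − s) + 1 ≤ A'' + a k₀ + a ℓ`,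
and `x(1 − g k₀)(1 − g ℓ) ≤ (1 − x)·g k₀·g ℓ` ⟹ `x ≤ TERM[s, a, g, j]`.  (`IndepBlob.tail_ge_of_companion_oneLight`.) [this work] -/
theorem term_ge_of_companion_oneLight (s : ℕ) (a : κ → ℕ) (g : κ → ℝ) (j : ℕ) (x : ℝ) (hx : 1 / 2 ≤ x) (hx1 : x ≤ 1)
    (hg : ∀ k, 0 ≤ g k ∧ g k ≤ 1) (ℓ k₀ : κ) (hne : k₀ ≠ ℓ) (hk₀x : x ≤ g k₀)
    (hheavy : ∀ k, k ≠ k₀ → k ≠ ℓ → x ≤ g k)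
    (hbig : 2 * (j - s) + 1 ≤ (∑ k ∈ ({k₀, ℓ} : Finset κ)ᶜ, a k) + 2 * a k₀)
    (hbℓ : 2 * (j - s) + 1 ≤ (∑ k ∈ ({k₀, ℓ} : Finset κ)ᶜ, a k) + a k₀ + a ℓ)
    (hodds : x * (1 - g k₀) * (1 - g ℓ) ≤ (1 - x) * g k₀ * g ℓ) :
    x ≤ TERM[s, a, g, j] := by
  by_cases hs : j + 1 ≤ s
  · rw [term_eq_one_of_sure s a g j hs]; exact hx1
  rw [term_shift s a g j (by omega)]
  exact IndepBlob.tail_ge_of_companion_oneLight g a x hx hx1 (fun k => (hg k).1) (fun k => (hg k).2) ℓ k₀ hne hk₀x hheavy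
    (j - s) hbig hbℓ hodds

end RootDec

end Quant

end Summit.CriticalPhenomena.PercolationContinuityZ3.Theorems
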